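import Mathlib
import Summits.Schanuel.Schanuel.Theses.RigidCore
import Summits.Schanuel.Schanuel.Theorems.AclSubsetLogFreeCore.Negative.ExpAclField
import Summits.Schanuel.Schanuel.Theorems.AclSubsetLogFreeCore.Negative.ExpAclDefinability
import Summits.Schanuel.Schanuel.Theorems.MinimalCounterexampleInAcl.Negative.FirstFailureEcl
import Summits.Schanuel.Schanuel.Theorems.RigidCoreMinimalCounterexampleInAclLogSector
import Literature.Barriers.Schanuel.LargeTranscendenceDegree
import Literature.Barriers.Schanuel.NesterenkoModularScopeConjectureProofs
import Literature.NumberTheory.Transcendental.OneMotiveToricProofs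

/-!
# The `acl`-FIELD CRITERION for (S*) — crux stmt-Schanuel-0969 `RigidCore.MinimalCounterexampleInAcl`

Line `kernel-arithmetic-selection` (lead prover-line-stmt-Schanuel-0969-c1-0), `--supports stmt-Schanuel-0969`.

The crux (S*) asks that every coordinate of a first-failure counterexample `x ∈ ℂⁿ` to Schanuel's conjecture
(`x` ℚ-linearly independent, `trdeg ℚ(x, eˣ) < n`, Schanuel in all ranks `< n`) lie in `acl^{ℂ_exp}(∅) =: expAcl`.
Since `expAcl` is a relatively algebraically closed, `exp`-closed subfield of `ℂ` (tree: `expAcl_relAlgClosed`,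
`exp_mem_expAcl`), the conclusion for `x` is a statement about the FIELD `K_x = ℚ(x, eˣ)` and is decided by
TRANSCENDENCE DEGREE alone:

* `subset_expAcl_of_algebraicIndependent` (CORE, rank-free, Schanuel-free): if an intermediate field `K` of `ℂ/ℚ`
  with `trdeg ℚ K ≤ m` contains `m` algebraically independent elements of `expAcl`, then `K ⊆ expAcl`.
* `firstFailure_mem_expAcl_of_intCombos` (every rank): at a first failure of rank `n = m + 1`, if `m` ℚ-linearly
  independent INTEGER combinations `u_k = Σ M_{ki} x_i` lie in `expAcl`, then ALL `x_i ∈ expAcl` — the rank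
  `SchanuelRank m` (a hypothesis of the crux, `m < n`) makes `ℚ(u, e^u) ⊆ expAcl` carry `trdeg ≥ m = trdeg K_x`.
  In particular (S*) is an "all-or-one-short" statement: `n − 1` coordinates in `acl(∅)` force the last one.
* RANK 2 (the first open rank): `firstFailure_two_mem_expAcl_of_transcendental` — (S*) holds at `x` as soon as SOME
  transcendental element of `expAcl` is ALGEBRAIC OVER `K_x`; corollaries: an algebraic coordinate
  (`…_of_isAlgebraic_coord`, Hermite–Lindemann), a non-zero integer combination in `expAcl` (`…_of_intCombo_mem`),
  `2πi` (or `π`) algebraic over `K_x` (`…_of_isAlgebraic_twoPiI`), and the characterisation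
  `firstFailure_two_mem_expAcl_iff`: (S*) at a rank-2 first failure `x` ⟺ `expAcl` meets the relative algebraic
  closure of `K_x` outside `ℚ̄`.  So the rank-2 residue of the crux lives exactly where `K_x^{alg} ∩ acl(∅) = ℚ̄`:
  both coordinates transcendental, no non-zero element of `span_ℤ x` in `acl(∅)`, `π` transcendental over `K_x`.

References: Kirby–Macintyre–Onshuus, *The algebraic numbers definable in various exponential fields*,
arXiv:1101.4224, §2 (`ℤ`, `2πi`, `π` are `∅`-definable/algebraic in `ℂ_exp`); J. Kirby, *Exponential algebraicity in
exponential fields*, arXiv:0810.4285, Prop. 7.2.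
-/

noncomputable section

set_option linter.dupNamespace false

open Complex Set FirstOrder Cardinal

namespace Summit.Schanuel.Schanuel.Cruxes.MinimalCounterexampleInAcl.KernelArithmeticSelection

open Literature.NumberTheory.Transcendental (SchanuelRank)
open Literature.ModelTheory.ExponentialFields
open Summit.Schanuel.Schanuel.Theorems.AclSubsetLogFreeCore.Negative
open Summit.Schanuel.Schanuel.Theorems.MinimalCounterexampleInAcl.Negative

variable {n : ℕ}

/-! ## Core: transcendence degree decides membership of a field in `acl(∅)` -/

/-- **CORE LEMMA.** If `b : Fin m → ℂ` is algebraically independent over `ℚ`, every `b i ∈ acl(∅)`, every `b i`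
lies in the intermediate field `K`, and `trdeg ℚ K < m + 1`, then `K ⊆ acl(∅)`: any `t ∈ K` transcendental over
`ℚ(b)` would give `m + 1` independent elements of `K`; so `t` is algebraic over `ℚ(b) ⊆ acl(∅)`, a relatively
algebraically closed subfield (`expAcl_relAlgClosed`). [folklore] -/
theorem subset_expAcl_of_algebraicIndependent {m : ℕ} {b : Fin m → ℂ} (hb : AlgebraicIndependent ℚ b)
    (hbacl : ∀ i, b i ∈ expAcl) (K : IntermediateField ℚ ℂ) (hbK : ∀ i, b i ∈ K)
    (htr : Algebra.trdeg ℚ K < ((m + 1 : ℕ) : Cardinal)) : (K : Set ℂ) ⊆ expAcl := by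
  intro t ht
  have halg : IsAlgebraic (Algebra.adjoin ℚ (range b)) t := by
    by_contra htrans
    have hind : AlgebraicIndependent ℚ (fun o : Option (Fin m) => o.elim t b) :=
      (hb.option_iff_transcendental t).2 htrans
    have hmem : ∀ o : Option (Fin m), (o.elim t b : ℂ) ∈ K := by
      rintro (_ | i)
      · exact ht
      · exact hbK i
    let v : Option (Fin m) → K := fun o => ⟨o.elim t b, hmem o⟩
    have hv : AlgebraicIndependent ℚ v := AlgebraicIndependent.of_comp K.val hind
    have hle := hv.cardinalMk_le_trdeg
    simp only [Cardinal.mk_fintype, Fintype.card_option, Fintype.card_fin] at hle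
    have : ((m + 1 : ℕ) : Cardinal) ≤ Algebra.trdeg ℚ K := by exact_mod_cast hle
    exact (not_le.2 htr) this
  have hle : Algebra.adjoin ℚ (range b) ≤ expAclField.toSubalgebra := by
    rw [Algebra.adjoin_le_iff]
    rintro a ⟨i, rfl⟩
    exact hbacl i
  exact expAcl_relAlgClosed t (halg.tower_top_of_subalgebra_le hle)

/-- From `m ≤ trdeg ℚ K < ℵ₀` extract `m` algebraically independent elements of `K` (a finite transcendence
basis has `trdeg` elements). [folklore] -/
theorem exists_algebraicIndependent_of_le_trdeg (K : IntermediateField ℚ ℂ) {m : ℕ}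
    (hm : (m : Cardinal) ≤ Algebra.trdeg ℚ K) (hfin : Algebra.trdeg ℚ K < ℵ₀) :
    ∃ b : Fin m → ℂ, AlgebraicIndependent ℚ b ∧ ∀ i, b i ∈ K := by
  obtain ⟨ι, v, hv⟩ := exists_isTranscendenceBasis' ℚ (A := K)
  have hcard : #ι = Algebra.trdeg ℚ K := hv.cardinalMk_eq_trdeg
  have hιfin : #ι < ℵ₀ := hcard ▸ hfin
  obtain ⟨hfinι⟩ : Nonempty (Fintype ι) := by
    rw [Cardinal.lt_aleph0_iff_fintype] at hιfin
    exact hιfin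
  have hmι : m ≤ Fintype.card ι := by
    have : (m : Cardinal) ≤ #ι := hcard ▸ hm
    rw [Cardinal.mk_fintype] at this
    exact_mod_cast this
  obtain ⟨e⟩ : Nonempty (Fin m ↪ ι) :=
    Function.Embedding.nonempty_of_card_le (by simpa using hmι)
  refine ⟨fun i => (v (e i) : ℂ), ?_, fun i => (v (e i)).2⟩
  have h1 : AlgebraicIndependent ℚ (v ∘ e) := hv.1.comp e e.injective
  exact h1.map' (f := K.val) Subtype.val_injective

/-! ## Every rank: `n − 1` independent integer combinations in `acl(∅)` force the whole tuple -/

/-- The field of a tuple. -/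
theorem mem_adjoin_self (x : Fin n → ℂ) (i : Fin n) :
    x i ∈ IntermediateField.adjoin ℚ (range x ∪ range (cexp ∘ x)) :=
  IntermediateField.subset_adjoin ℚ _ (Or.inl ⟨i, rfl⟩)

/-- The field of a tuple contains the exponentials. -/
theorem cexp_mem_adjoin_self (x : Fin n → ℂ) (i : Fin n) :
    cexp (x i) ∈ IntermediateField.adjoin ℚ (range x ∪ range (cexp ∘ x)) :=
  IntermediateField.subset_adjoin ℚ _ (Or.inr ⟨i, rfl⟩)

/-- An integer combination of the tuple lies in its field. -/
theorem intCombo_mem_adjoin (x : Fin n → ℂ) (M : Fin n → ℤ) :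
    (∑ i, (M i : ℂ) * x i) ∈ IntermediateField.adjoin ℚ (range x ∪ range (cexp ∘ x)) :=
  sum_mem fun i _ => mul_mem (intCast_mem _ (M i)) (mem_adjoin_self x i)

/-- The exponential of an integer combination is a monomial in the exponentials, hence lies in the field. -/
theorem cexp_intCombo_mem_adjoin (x : Fin n → ℂ) (M : Fin n → ℤ) :
    cexp (∑ i, (M i : ℂ) * x i) ∈ IntermediateField.adjoin ℚ (range x ∪ range (cexp ∘ x)) := by
  rw [Complex.exp_sum]
  refine prod_mem fun i _ => ?_
  rw [Complex.exp_int_mul]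
  exact zpow_mem (cexp_mem_adjoin_self x i) (M i)

/-- **(S*) IS ALL-OR-ONE-SHORT (every rank).** At a first failure `x` of rank `n = m + 1`: if `m` ℚ-linearly
independent INTEGER combinations `u_k = Σ_i M_{ki} x_i` lie in `acl(∅)`, then every `x_i ∈ acl(∅)`.  Proof:
`ℚ(u, e^u) ⊆ K_x ∩ acl(∅)` (`acl(∅)` is an `exp`-closed subfield), `SchanuelRank m` (hypothesis of the crux at
`m < n`) gives `trdeg ℚ(u, e^u) ≥ m`, while `trdeg K_x < n = m + 1`; apply the core lemma.  In particular, `n − 1`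
coordinates of a first failure in `acl(∅)` force the last one. [cite: Kirby2010, Prop. 7.2 (first-failure form)] -/
theorem firstFailure_mem_expAcl_of_intCombos {x : Fin n → ℂ} (hx : x ∈ firstFailures n) {m : ℕ}
    (hmn : n = m + 1) (M : Fin m → Fin n → ℤ)
    (hli : LinearIndependent ℚ (fun k => ∑ i, (M k i : ℂ) * x i))
    (hacl : ∀ k, (∑ i, (M k i : ℂ) * x i) ∈ expAcl) : ∀ i, x i ∈ expAcl := by
  rcases hx with ⟨-, htr, hSR⟩
  set u : Fin m → ℂ := fun k => ∑ i, (M k i : ℂ) * x i with hu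
  set K : IntermediateField ℚ ℂ := IntermediateField.adjoin ℚ (range x ∪ range (cexp ∘ x)) with hK
  set Ku : IntermediateField ℚ ℂ := IntermediateField.adjoin ℚ (range u ∪ range (cexp ∘ u)) with hKu
  -- `ℚ(u, e^u) ≤ K_x`
  have hKuK : Ku ≤ K := by
    rw [hKu, IntermediateField.adjoin_le_iff]
    rintro a (⟨k, rfl⟩ | ⟨k, rfl⟩)
    · exact intCombo_mem_adjoin x (M k)
    · exact cexp_intCombo_mem_adjoin x (M k)
  -- `ℚ(u, e^u) ⊆ acl(∅)`
  have hKuAcl : Ku ≤ expAclField := by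
    rw [hKu, IntermediateField.adjoin_le_iff]
    rintro a (⟨k, rfl⟩ | ⟨k, rfl⟩)
    · exact hacl k
    · exact exp_mem_expAcl (hacl k)
  -- `SchanuelRank m` on `u`
  have hm : (m : Cardinal) ≤ Algebra.trdeg ℚ Ku := hSR m (by omega) u hli
  have hfinK : Algebra.trdeg ℚ K < ℵ₀ := htr.trans (Cardinal.natCast_lt_aleph0)
  have hfinKu : Algebra.trdeg ℚ Ku < ℵ₀ := (Literature.Barriers.Schanuel.trdeg_mono hKuK).trans_lt hfinK
  obtain ⟨b, hb, hbKu⟩ := exists_algebraicIndependent_of_le_trdeg Ku hm hfinKu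
  have htr' : Algebra.trdeg ℚ K < ((m + 1 : ℕ) : Cardinal) := by rw [← hmn]; exact htr
  have hsub := subset_expAcl_of_algebraicIndependent hb (fun i => hKuAcl (hbKu i)) K (fun i => hKuK (hbKu i)) htr'
  exact fun i => hsub (mem_adjoin_self x i)

/-! ## Rank 2: any transcendental `∅`-algebraic number algebraic over `ℚ(x, eˣ)` settles (S*) at `x` -/

/-- Every algebraic number is in `acl(∅)` (re-export of the tree's relative algebraic closedness). [folklore] -/
theorem mem_expAcl_of_isAlgebraic' {a : ℂ} (ha : IsAlgebraic ℚ a) : a ∈ expAcl :=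
  expAcl_relAlgClosed a (ha.tower_top (L := ↥expAclField))

/-- **RANK-2 CRITERION.** Let `x` be a rank-2 first failure and `κ ∈ acl(∅)` transcendental (over `ℚ`) and
algebraic over `K_x = ℚ(x, eˣ)`.  Then both coordinates of `x` lie in `acl(∅)`: `trdeg ℚ K_x(κ) = trdeg ℚ K_x < 2`
while `κ` is one independent element of `K_x(κ) ∩ acl(∅)`; apply the core lemma to `K_x(κ) ⊇ K_x ∋ x_i`.
[cite: KirbyMacintyreOnshuus2012, §2] -/
theorem firstFailure_two_mem_expAcl_of_transcendental {x : Fin 2 → ℂ} (hx : x ∈ firstFailures 2) {κ : ℂ}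
    (hκ : κ ∈ expAcl) (hκt : Transcendental ℚ κ)
    (hκK : IsAlgebraic (IntermediateField.adjoin ℚ (range x ∪ range (cexp ∘ x))) κ) :
    ∀ i, x i ∈ expAcl := by
  rcases hx with ⟨-, htr, -⟩
  set S : Set ℂ := range x ∪ range (cexp ∘ x) with hS
  set L : IntermediateField ℚ ℂ := IntermediateField.adjoin ℚ (S ∪ {κ}) with hL
  have htrL : Algebra.trdeg ℚ L = Algebra.trdeg ℚ (IntermediateField.adjoin ℚ S) :=
    Literature.Barriers.Schanuel.trdeg_adjoin_union_eq_of_isAlgebraic_adjoin S {κ}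
      (fun a ha => by rw [mem_singleton_iff.1 ha]; exact hκK)
  have htrL2 : Algebra.trdeg ℚ L < ((1 + 1 : ℕ) : Cardinal) := by
    rw [htrL]; exact_mod_cast htr
  have hb : AlgebraicIndependent ℚ ![κ] := algebraicIndependent_unique_type_iff.2 (by simpa using hκt)
  have hκL : κ ∈ L := IntermediateField.subset_adjoin ℚ _ (Or.inr rfl)
  have hsub := subset_expAcl_of_algebraicIndependent hb (fun i => by fin_cases i; simpa using hκ) L
    (fun i => by fin_cases i; simpa using hκL) htrL2
  intro i
  exact hsub (IntermediateField.subset_adjoin ℚ _ (Or.inl (Or.inl ⟨i, rfl⟩)))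

/-- Variant: `κ ∈ K_x` itself. -/
theorem firstFailure_two_mem_expAcl_of_transcendental_mem {x : Fin 2 → ℂ} (hx : x ∈ firstFailures 2) {κ : ℂ}
    (hκ : κ ∈ expAcl) (hκt : Transcendental ℚ κ)
    (hκK : κ ∈ IntermediateField.adjoin ℚ (range x ∪ range (cexp ∘ x))) : ∀ i, x i ∈ expAcl :=
  firstFailure_two_mem_expAcl_of_transcendental hx hκ hκt
    (isAlgebraic_algebraMap (⟨κ, hκK⟩ : IntermediateField.adjoin ℚ (range x ∪ range (cexp ∘ x))))

/-- **An ALGEBRAIC COORDINATE settles (S*) at rank 2**: if some `x j` is algebraic then both coordinates lie in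
`acl(∅)` — `x j ≠ 0` (linear independence), so `e^{x j}` is transcendental (Hermite–Lindemann, tree
`SchanuelRank 1`) and lies in `K_x ∩ acl(∅)` (`acl(∅) ∋ x j` is `exp`-closed). Covers the classical candidate pairs
`(1, e)`, `(1, πi)`, `(α, log β)`. [cite: KirbyMacintyreOnshuus2012, §2] -/
theorem firstFailure_two_mem_expAcl_of_isAlgebraic_coord {x : Fin 2 → ℂ} (hx : x ∈ firstFailures 2) {j : Fin 2}
    (hj : IsAlgebraic ℚ (x j)) : ∀ i, x i ∈ expAcl := by
  have hli := hx.1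
  have hxj0 : x j ≠ 0 := hli.ne_zero j
  -- Hermite–Lindemann via `SchanuelRank 1` on the 1-tuple `x j`
  have htrans : Transcendental ℚ (cexp (x j)) := by
    intro halg
    have h1 : SchanuelRank 1 := schanuelRank_one
    have hli1 : LinearIndependent ℚ ![x j] := by
      exact linearIndependent_unique_iff.2 (by simpa using hxj0)
    have hle := h1 ![x j] hli1
    -- the field `ℚ(x j, e^{x j})` is algebraic, so its trdeg is 0
    have halgF : Algebra.IsAlgebraic ℚ
        ↥(IntermediateField.adjoin ℚ (range ![x j] ∪ range (cexp ∘ ![x j]))) := by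
      apply IntermediateField.isAlgebraic_adjoin
      rintro a (⟨i, rfl⟩ | ⟨i, rfl⟩)
      · fin_cases i; simpa using hj.isIntegral
      · fin_cases i; simpa using halg.isIntegral
    have h0 : Algebra.trdeg ℚ ↥(IntermediateField.adjoin ℚ (range ![x j] ∪ range (cexp ∘ ![x j]))) = 0 :=
      trdeg_eq_zero
    rw [h0] at hle
    exact absurd hle (by norm_num)
  exact firstFailure_two_mem_expAcl_of_transcendental_mem hx (exp_mem_expAcl (mem_expAcl_of_isAlgebraic' hj))
    htrans (cexp_mem_adjoin_self x j)

/-- **A NON-ZERO INTEGER COMBINATION IN `acl(∅)` settles (S*) at rank 2**: if `u = M₀ x₀ + M₁ x₁ ∈ acl(∅)` with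
`M ≠ 0`, then both coordinates lie in `acl(∅)` (`u ≠ 0` by linear independence; if `u` is transcendental use it,
otherwise `e^u ∈ K_x ∩ acl(∅)` is transcendental by Hermite–Lindemann).  Instances: `x j ∈ ℚπi`, `π ∈ span_ℤ x`,
the line case `x₁ = c x₀ + d` (`c, d ∈ ℚ`, `d ≠ 0`). [cite: KirbyMacintyreOnshuus2012, §2] -/
theorem firstFailure_two_mem_expAcl_of_intCombo_mem {x : Fin 2 → ℂ} (hx : x ∈ firstFailures 2)
    (M : Fin 2 → ℤ) (hM : M ≠ 0) (hacl : (∑ i, (M i : ℂ) * x i) ∈ expAcl) : ∀ i, x i ∈ expAcl := by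
  have hli := hx.1
  set u : ℂ := ∑ i, (M i : ℂ) * x i with hu
  have hu0 : u ≠ 0 := by
    intro h0
    -- `Σ (M i : ℚ) • x i = 0` contradicts linear independence
    have h := (Fintype.linearIndependent_iff.1 hli) (fun i => (M i : ℚ)) (by
      simpa [hu, Rat.smul_def, ← Int.cast_smul_eq_zsmul ℚ, zsmul_eq_mul] using h0)
    apply hM
    funext i
    exact_mod_cast h i
  by_cases hut : Transcendental ℚ u
  · exact firstFailure_two_mem_expAcl_of_transcendental_mem hx hacl hut (intCombo_mem_adjoin x M)
  · have hualg : IsAlgebraic ℚ u := by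
      simpa [Transcendental] using hut
    -- Hermite–Lindemann: `e^u` transcendental
    have htrans : Transcendental ℚ (cexp u) := by
      intro halg
      have h1 : SchanuelRank 1 := schanuelRank_one
      have hli1 : LinearIndependent ℚ ![u] := by
        exact linearIndependent_unique_iff.2 (by simpa using hu0)
      have hle := h1 ![u] hli1
      have halgF : Algebra.IsAlgebraic ℚ
          ↥(IntermediateField.adjoin ℚ (range ![u] ∪ range (cexp ∘ ![u]))) := by
        apply IntermediateField.isAlgebraic_adjoin
        rintro a (⟨i, rfl⟩ | ⟨i, rfl⟩)
        · fin_cases i; simpa using hualg.isIntegral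
        · fin_cases i; simpa using halg.isIntegral
      have h0 : Algebra.trdeg ℚ ↥(IntermediateField.adjoin ℚ (range ![u] ∪ range (cexp ∘ ![u]))) = 0 :=
        trdeg_eq_zero
      rw [h0] at hle
      exact absurd hle (by norm_num)
    exact firstFailure_two_mem_expAcl_of_transcendental_mem hx (exp_mem_expAcl hacl) htrans
      (cexp_intCombo_mem_adjoin x M)

/-- **`2πi` ALGEBRAIC OVER `ℚ(x, eˣ)` settles (S*) at rank 2** (`2πi ∈ acl(∅)` by kernel rigidity,
`two_pi_I_mem_expAcl`; `π` is transcendental, tree `transcendental_pi_holds`).  So the residue of the crux at the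
first open rank lives where `π` is TRANSCENDENTAL over `ℚ(x, eˣ)` — the "Case A" world of the sweep.
[cite: KirbyMacintyreOnshuus2012, §2.3] -/
theorem firstFailure_two_mem_expAcl_of_isAlgebraic_twoPiI {x : Fin 2 → ℂ} (hx : x ∈ firstFailures 2)
    (h : IsAlgebraic (IntermediateField.adjoin ℚ (range x ∪ range (cexp ∘ x))) (2 * ↑Real.pi * I)) :
    ∀ i, x i ∈ expAcl := by
  exact firstFailure_two_mem_expAcl_of_transcendental hx two_pi_I_mem_expAcl
    Literature.NumberTheory.Transcendental.transcendental_two_pi_I h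

/-- **CHARACTERISATION at rank 2.** For a rank-2 first failure `x`: every coordinate lies in `acl(∅)` iff SOME
transcendental element of `acl(∅)` is algebraic over `ℚ(x, eˣ)` (⟸ the criterion; ⟹ `x₀` itself if transcendental,
else `e^{x₀}` by Hermite–Lindemann).  Equivalently: (S*) fails at `x` iff `acl(∅)` meets the relative algebraic
closure of `ℚ(x, eˣ)` inside `ℚ̄` only. [cite: KirbyMacintyreOnshuus2012, §2] -/
theorem firstFailure_two_mem_expAcl_iff {x : Fin 2 → ℂ} (hx : x ∈ firstFailures 2) :
    (∀ i, x i ∈ expAcl) ↔ ∃ κ : ℂ, κ ∈ expAcl ∧ Transcendental ℚ κ ∧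
      IsAlgebraic (IntermediateField.adjoin ℚ (range x ∪ range (cexp ∘ x))) κ := by
  constructor
  · intro h
    by_cases h0 : Transcendental ℚ (x 0)
    · exact ⟨x 0, h 0, h0, isAlgebraic_algebraMap
        (⟨x 0, mem_adjoin_self x 0⟩ : IntermediateField.adjoin ℚ (range x ∪ range (cexp ∘ x)))⟩
    · have halg : IsAlgebraic ℚ (x 0) := by simpa [Transcendental] using h0
      have hx00 : x 0 ≠ 0 := hx.1.ne_zero 0
      have htrans : Transcendental ℚ (cexp (x 0)) := by
        intro halg'
        have h1 : SchanuelRank 1 := schanuelRank_one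
        have hli1 : LinearIndependent ℚ ![x 0] := by
          exact linearIndependent_unique_iff.2 (by simpa using hx00)
        have hle := h1 ![x 0] hli1
        have halgF : Algebra.IsAlgebraic ℚ
            ↥(IntermediateField.adjoin ℚ (range ![x 0] ∪ range (cexp ∘ ![x 0]))) := by
          apply IntermediateField.isAlgebraic_adjoin
          rintro a (⟨i, rfl⟩ | ⟨i, rfl⟩)
          · fin_cases i; simpa using halg.isIntegral
          · fin_cases i; simpa using halg'.isIntegral
        have h00 : Algebra.trdeg ℚ ↥(IntermediateField.adjoin ℚ (range ![x 0] ∪ range (cexp ∘ ![x 0]))) = 0 :=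
          trdeg_eq_zero
        rw [h00] at hle
        exact absurd hle (by norm_num)
      exact ⟨cexp (x 0), exp_mem_expAcl (h 0), htrans, isAlgebraic_algebraMap
        (⟨cexp (x 0), cexp_mem_adjoin_self x 0⟩ : IntermediateField.adjoin ℚ (range x ∪ range (cexp ∘ x)))⟩
  · rintro ⟨κ, hκ, hκt, hκK⟩
    exact firstFailure_two_mem_expAcl_of_transcendental hx hκ hκt hκK

/-! ## Registered forms (explicit binders, fully inlined; `ledger workitem stub-add stmt-Schanuel-0969 …`) -/

/-- Registered form of `firstFailure_mem_expAcl_of_intCombos` (stub `stub_aclCriterion_allOrOneShort`). -/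
theorem stub_aclCriterion_allOrOneShort : ∀ (n m : ℕ) (x : Fin n → ℂ), x ∈ Summit.Schanuel.Schanuel.Cruxes.MinimalCounterexampleInAcl.KernelArithmeticSelection.firstFailures n → n = m + 1 → ∀ (M : Fin m → Fin n → ℤ), LinearIndependent ℚ (fun k => ∑ i, (M k i : ℂ) * x i) → (∀ k, (∑ i, (M k i : ℂ) * x i) ∈ Summit.Schanuel.Schanuel.Theorems.AclSubsetLogFreeCore.Negative.expAcl) → ∀ i, x i ∈ Summit.Schanuel.Schanuel.Theorems.AclSubsetLogFreeCore.Negative.expAcl :=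
  fun _ _ _ hx hmn M hli hacl => firstFailure_mem_expAcl_of_intCombos hx hmn M hli hacl

/-- Registered form of `firstFailure_two_mem_expAcl_iff` (stub `stub_aclCriterion_rankTwo_iff`). -/
theorem stub_aclCriterion_rankTwo_iff : ∀ (x : Fin 2 → ℂ), x ∈ Summit.Schanuel.Schanuel.Cruxes.MinimalCounterexampleInAcl.KernelArithmeticSelection.firstFailures 2 → ((∀ i, x i ∈ Summit.Schanuel.Schanuel.Theorems.AclSubsetLogFreeCore.Negative.expAcl) ↔ ∃ κ : ℂ, κ ∈ Summit.Schanuel.Schanuel.Theorems.AclSubsetLogFreeCore.Negative.expAcl ∧ Transcendental ℚ κ ∧ IsAlgebraic ↥(IntermediateField.adjoin ℚ (Set.range x ∪ Set.range (Complex.exp ∘ x))) κ) :=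
  fun _ hx => firstFailure_two_mem_expAcl_iff hx

end Summit.Schanuel.Schanuel.Cruxes.MinimalCounterexampleInAcl.KernelArithmeticSelection

end
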